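import Summits.MatrixMultiplication.OmegaCensus.STPPSmallPatternT2Order32Hosts
import Summits.MatrixMultiplication.OmegaCensus.STPPSmallPatternT1OnsetsSmall
import Summits.MatrixMultiplication.OmegaCensus.STPPSmallPatternTableWitnessesT1
import Summits.MatrixMultiplication.OmegaCensus.STPPSmallPatternNone211K4B
import Summits.MatrixMultiplication.OmegaCensus.STPPSmallPatternNone211K4Z2pow4

/-!
# ω-census, small STPP pattern `(2,1,1)^k`: THE ORDER-16 HOST LIST OF `(2,1,1)⁴` IS EXACT (kernel, all abelian groups of order 16)

HONEST FRAMING (pub-omega census; verbatim): lottery ticket; floor = certified bounds/negative ranges.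
Census STRUCTURE bookkeeping of the STPP track (seat pub-omega-stpp-3, gen 25; STRUCTURE row B5: the threshold column
`T1(H) = max {k : (2,1,1)^k ⊆ H}` at the onset order `16` of `(2,1,1)⁴`, and the LIFT-TIGHT law `onset_T2(4) = 2 · onset_T1(4) = 32`),
not progress on `ω`: small patterns in small groups bound no exponent.

The twin of `STPPSmallPatternT2Order32Hosts.lean` one storey down.  The all-abelian onset of `(2,1,1)⁴` is `16`
(`not_exists_isSTPP_211pow4_of_card_le`: no host of order `≤ 15`; `ℤ/2 × ℤ/8` hosts).  AT order `16` every cell is already in the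
kernel: `ℤ/2 × ℤ/8`, `ℤ/4 × ℤ/4`, `ℤ/2 × ℤ/2 × ℤ/4` host (stpp-3 gen 23 / ENG2 gen 31 witnesses), `ℤ/16` does not (stpp-3 gen 23,
`STPPSmallPatternNone211K4B`), `(ℤ/2)⁴` does not (ENG2 gen 31, `STPPSmallPatternNone211K4Z2pow4`).  This file states the host list
INTRINSICALLY, exactly as at order `32` for `(1,2,2)⁴`:

* `stpp211pow4_order16_iff` — **a finite abelian group `G` of order `16` admits an STPP family of size pattern `(2,1,1)⁴` iff `G` is
  neither cyclic nor elementary abelian**;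
* `stpp211pow4_order16_hosts` — the five types one by one;
* `stpp_order16_order32_same_shape` — the two host lists side by side (the fat-quotient lift `T2(G) ≥ T1(G/N)` of
  `STPPFatQuotientLift.lean` explains the five hosts of order `32` from the three of order `16`; the two theorems say the exceptions
  match too: cyclic and elementary abelian, at both orders).

References: H. Cohn, R. Kleinberg, B. Szegedy, C. Umans, FOCS 2005 (arXiv:math/0511460), Def. 5.1.  Record: pub-omega HOME
`pub-omega-stpp-3-g25/`.
-/

open Literature.Computability.AlgebraicComplexity Finset

namespace Summit.MatrixMultiplication.OmegaCensus

/-! ## 1. Order 16: cyclic, elementary, or a host type inside -/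

/-- COMBINATORIAL CORE (kernel): a capped multiset of prime powers with product `16` is `{16}`, or `{2,2,2,2}`, or dominated by one of
the three host types. -/
theorem hostCore211K4Order16 : ∀ E ∈ List.range' 1 16, ∀ M ∈ subMS (capList E), M.prod = 16 →
    dom [16] M = true ∨ dom [2, 2, 2, 2] M = true ∨
      ∃ s ∈ ([[2, 8], [4, 4], [2, 2, 4]] : List (List ℕ)), dom s M = true := by
  decide +kernel

/-- **TRICHOTOMY AT ORDER 16**: a finite abelian group of order `16` is in bijection (additively) with `ℤ/16`, or with `(ℤ/2)⁴`, or one of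
the three host types embeds into it. [folklore] -/
theorem order16_trichotomy {G : Type*} [AddCommGroup G] [Finite G] (hG : Nat.card G = 16) :
    (∃ φ : SeedType [16] →+ G, Function.Bijective φ) ∨ (∃ φ : SeedType [2, 2, 2, 2] →+ G, Function.Bijective φ) ∨
      ∃ s ∈ ([[2, 8], [4, 4], [2, 2, 4]] : List (List ℕ)), ∃ φ : SeedType s →+ G, Function.Injective φ := by
  classical
  obtain ⟨ι, _, p, hp, e, ⟨g⟩⟩ := AddCommGroup.equiv_directSum_zmod_of_finite G
  let f : G ≃+ (Π i, ZMod (p i ^ e i)) :=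
    g.trans (DirectSum.linearEquivFunOnFintype ℕ ι (fun i => ZMod (p i ^ e i))).toAddEquiv
  have hE1 : 1 ≤ AddMonoid.exponent G := Nat.pos_of_ne_zero AddMonoid.exponent_ne_zero_of_finite
  have hEle : AddMonoid.exponent G ≤ 16 := le_trans (Nat.le_of_dvd Nat.card_pos AddGroup.exponent_dvd_nat_card) hG.le
  have hdvd : ∀ i, p i ^ e i ∣ AddMonoid.exponent G := fun i => by
    have hinj : Function.Injective (AddMonoidHom.single (fun j => ZMod (p j ^ e j)) i) :=
      Pi.single_injective (M := fun j => ZMod (p j ^ e j)) i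
    have h1 : addOrderOf (f.symm (AddMonoidHom.single (fun j => ZMod (p j ^ e j)) i 1)) = p i ^ e i := by
      rw [AddEquiv.addOrderOf_eq, addOrderOf_injective _ hinj, ZMod.addOrderOf_one]
    rw [← h1]
    exact AddMonoid.addOrder_dvd_exponent _
  have hcardeq : Nat.card G = ∏ i, p i ^ e i := by
    rw [Nat.card_congr f.toEquiv, Nat.card_pi]
    simp [Nat.card_zmod]
  have hq0 : ∀ i, p i ^ e i ≠ 0 := fun i => pow_ne_zero _ (hp i).ne_zero
  haveI : ∀ i, NeZero (p i ^ e i) := fun i => ⟨hq0 i⟩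
  set M : Multiset ℕ := (Finset.univ.filter fun i => 0 < e i).val.map fun i => p i ^ e i with hM
  have hprodeq : M.prod = ∏ i, p i ^ e i := by
    rw [hM, ← Finset.prod_eq_multiset_prod]
    exact Finset.prod_filter_of_ne fun i _ hi => Nat.pos_of_ne_zero fun h0 => hi (by rw [h0, pow_zero])
  have hmem : ∀ a ∈ M, a ∈ ppList ∧ a ∣ AddMonoid.exponent G := by
    intro a ha
    obtain ⟨i, hi, rfl⟩ := Multiset.mem_map.1 ha
    have hi' : 0 < e i := (Finset.mem_filter.1 hi).2
    exact ⟨pow_mem_ppList (hp i) hi' (le_trans (Nat.le_of_dvd (by omega) (hdvd i)) (le_trans hEle (by norm_num))), hdvd i⟩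
  have hEI : AddMonoid.exponent G ∈ List.range' 1 16 := List.mem_range'_1.2 ⟨hE1, by omega⟩
  have hEI45 : AddMonoid.exponent G ∈ List.range' 1 45 := List.mem_range'_1.2 ⟨hE1, by omega⟩
  have h16 : M.prod = 16 := by rw [hprodeq, ← hcardeq, hG]
  have hle : M ≤ capMS (capList (AddMonoid.exponent G)) :=
    le_capMS_of_prod_le45 hEI45 (fun a ha => (hmem a ha).1) (fun a ha => (hmem a ha).2) (by omega)
  have hcardPi : Nat.card (Π i, ZMod (p i ^ e i)) = 16 := by rw [← Nat.card_congr f.toEquiv, hG]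
  have bij_of_dom : ∀ s : List ℕ, s.prod = 16 → dom s M = true → ∃ φ : SeedType s →+ G, Function.Bijective φ := by
    intro s hs hD
    obtain ⟨φ, hφ, -⟩ := exists_emb_of_dom (fun i => p i ^ e i) hq0 s _ hD
    have hcard : Nat.card (SeedType s) = Nat.card (Π i, ZMod (p i ^ e i)) := by rw [card_seedType, hs, hcardPi]
    have hbij : Function.Bijective φ := hφ.bijective_of_nat_card_le (le_of_eq hcard.symm)
    exact ⟨f.symm.toAddMonoidHom.comp φ, f.symm.bijective.comp hbij⟩
  rcases hostCore211K4Order16 _ hEI M (mem_subMS_of_le _ _ hle) h16 with h1 | h2 | ⟨s, hs, hD⟩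
  · exact Or.inl (bij_of_dom [16] (by norm_num) h1)
  · exact Or.inr (Or.inl (bij_of_dom [2, 2, 2, 2] (by norm_num) h2))
  · obtain ⟨φ, hφ, -⟩ := exists_emb_of_dom (fun i => p i ^ e i) hq0 s _ hD
    exact Or.inr (Or.inr ⟨s, hs, f.symm.toAddMonoidHom.comp φ, f.symm.injective.comp hφ⟩)

/-! ## 2. The three host types host; `ℤ/16` and `(ℤ/2)⁴` -/

/-- Each of the three host types admits `(2,1,1)⁴` (kernel witnesses of stpp-3 gen 23 / ENG2 gen 31, read on `SeedType`).
[cite: CohnKleinbergSzegedyUmans2005, Def. 5.1] -/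
theorem exists_211pow4_of_mem_hostSeeds16 :
    ∀ s ∈ ([[2, 8], [4, 4], [2, 2, 4]] : List (List ℕ)),
      ∃ A B C : Fin 4 → Finset (SeedType s), IsSTPP A B C ∧ ∀ i, (A i).card = 2 ∧ (B i).card = 1 ∧ (C i).card = 1 := by
  intro s hs
  simp only [List.mem_cons, List.mem_nil_iff, or_false] at hs
  rcases hs with rfl | rfl | rfl
  · exact exists_isSTPP_211pow4_zmod2_zmod8
  · exact exists_isSTPP_211pow4_zmod4_zmod4
  · exact exists_isSTPP_211pow4_zmod2_zmod2_zmod4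

/-- Each of the three host types has an element not killed by `2` (kernel). [folklore] -/
theorem exists_two_nsmul_ne_zero_of_mem_hostSeeds16 :
    ∀ s ∈ ([[2, 8], [4, 4], [2, 2, 4]] : List (List ℕ)), ∃ y : SeedType s, 2 • y ≠ 0 := by
  intro s hs
  simp only [List.mem_cons, List.mem_nil_iff, or_false] at hs
  rcases hs with rfl | rfl | rfl
  · exact ⟨((0 : ZMod 2), (1 : ZMod 8)), by show 2 • ((0 : ZMod 2), (1 : ZMod 8)) ≠ 0; decide⟩
  · exact ⟨((0 : ZMod 4), (1 : ZMod 4)), by show 2 • ((0 : ZMod 4), (1 : ZMod 4)) ≠ 0; decide⟩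
  · exact ⟨((0 : ZMod 2), (0 : ZMod 2), (1 : ZMod 4)), by show 2 • ((0 : ZMod 2), (0 : ZMod 2), (1 : ZMod 4)) ≠ 0; decide⟩

/-- `(ℤ/2)⁴` is elementary abelian (kernel). [folklore] -/
theorem two_nsmul_eq_zero_seed2222 : ∀ y : SeedType [2, 2, 2, 2], 2 • y = 0 := by
  show ∀ y : ZMod 2 × ZMod 2 × ZMod 2 × ZMod 2, 2 • y = 0
  decide

/-- `ℤ/16` is not elementary abelian (kernel). [folklore] -/
theorem exists_two_nsmul_ne_zero_seed16 : ∃ y : SeedType [16], 2 • y ≠ 0 :=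
  ⟨(1 : ZMod 16), by show 2 • (1 : ZMod 16) ≠ 0; decide⟩

/-! ## 3. The host list over all finite abelian groups of order 16 -/

/-- **A cyclic group of order `16` admits no `(2,1,1)⁴`** (kernel cell `ℤ/16` of stpp-3 gen 23 transported).
[cite: CohnKleinbergSzegedyUmans2005, Def. 5.1] -/
theorem not_exists_isSTPP_211pow4_of_isAddCyclic_card_16 {G : Type*} [AddCommGroup G] [Finite G] (hG : Nat.card G = 16)
    [hc : IsAddCyclic G] :
    ¬ ∃ A B C : Fin 4 → Finset G, IsSTPP A B C ∧ ∀ i, (A i).card = 2 ∧ (B i).card = 1 ∧ (C i).card = 1 := by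
  have hcard : Nat.card (ZMod 16) = Nat.card G := by rw [Nat.card_zmod, hG]
  let e : ZMod 16 ≃+ G := addEquivOfAddCyclicCardEq hcard
  exact not_exists_isSTPP_211_of_card_eq e.toAddMonoidHom e.injective hcard not_exists_isSTPP_211pow4_zmod16

/-- **An elementary abelian group of order `16` admits no `(2,1,1)⁴`** (it is `(ℤ/2)⁴`: ENG2's kernel cell transported).
[cite: CohnKleinbergSzegedyUmans2005, Def. 5.1] -/
theorem not_exists_isSTPP_211pow4_of_two_nsmul_eq_zero_card_16 {G : Type*} [AddCommGroup G] [Finite G] (hG : Nat.card G = 16)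
    (h2 : ∀ x : G, 2 • x = 0) :
    ¬ ∃ A B C : Fin 4 → Finset G, IsSTPP A B C ∧ ∀ i, (A i).card = 2 ∧ (B i).card = 1 ∧ (C i).card = 1 := by
  rcases order16_trichotomy hG with ⟨φ, hφ⟩ | ⟨φ, hφ⟩ | ⟨s, hs, φ, hφ⟩
  · exfalso
    obtain ⟨y, hy⟩ := exists_two_nsmul_ne_zero_seed16
    apply hy
    apply hφ.1
    rw [map_nsmul, map_zero]; exact h2 _
  · have hcard : Nat.card (SeedType [2, 2, 2, 2]) = Nat.card G := by rw [card_seedType, hG]; norm_num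
    exact not_exists_isSTPP_211_of_card_eq φ hφ.1 hcard not_exists_isSTPP_211pow4_z2_z2_z2_z2
  · exfalso
    obtain ⟨y, hy⟩ := exists_two_nsmul_ne_zero_of_mem_hostSeeds16 s hs
    apply hy
    apply hφ
    rw [map_nsmul, map_zero]; exact h2 _

/-- **A finite abelian group of order `16` that is neither cyclic nor elementary abelian admits `(2,1,1)⁴`.**
[cite: CohnKleinbergSzegedyUmans2005, Def. 5.1] -/
theorem exists_isSTPP_211pow4_of_card_16 {G : Type*} [AddCommGroup G] [Finite G] (hG : Nat.card G = 16) (hc : ¬ IsAddCyclic G)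
    (h2 : ¬ ∀ x : G, 2 • x = 0) :
    ∃ A B C : Fin 4 → Finset G, IsSTPP A B C ∧ ∀ i, (A i).card = 2 ∧ (B i).card = 1 ∧ (C i).card = 1 := by
  classical
  rcases order16_trichotomy hG with ⟨φ, hφ⟩ | ⟨φ, hφ⟩ | ⟨s, hs, φ, hφ⟩
  · exfalso
    haveI : IsAddCyclic (SeedType [16]) := show IsAddCyclic (ZMod 16) from inferInstance
    exact hc (isAddCyclic_of_surjective φ hφ.2)
  · exfalso
    refine h2 fun x => ?_
    obtain ⟨y, rfl⟩ := hφ.2 x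
    rw [← map_nsmul, two_nsmul_eq_zero_seed2222, map_zero]
  · exact exists_isSTPP_211_of_injective φ hφ (exists_211pow4_of_mem_hostSeeds16 s hs)

/-- **THE ORDER-16 HOST LIST OF `(2,1,1)⁴`, INTRINSIC FORM (kernel, all finite abelian groups of order `16`): `G` admits an STPP family
of size pattern `(2,1,1)⁴` (CKSU Def. 5.1) iff `G` is neither cyclic nor elementary abelian.**  No `ω` bound follows.
[cite: CohnKleinbergSzegedyUmans2005, Def. 5.1] -/
theorem stpp211pow4_order16_iff {G : Type*} [AddCommGroup G] [Finite G] (hG : Nat.card G = 16) :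
    (∃ A B C : Fin 4 → Finset G, IsSTPP A B C ∧ ∀ i, (A i).card = 2 ∧ (B i).card = 1 ∧ (C i).card = 1) ↔
      (¬ IsAddCyclic G ∧ ¬ ∀ x : G, 2 • x = 0) := by
  constructor
  · intro h
    refine ⟨fun hc => ?_, fun h2 => ?_⟩
    · exact not_exists_isSTPP_211pow4_of_isAddCyclic_card_16 hG h
    · exact not_exists_isSTPP_211pow4_of_two_nsmul_eq_zero_card_16 hG h2 h
  · rintro ⟨hc, h2⟩
    exact exists_isSTPP_211pow4_of_card_16 hG hc h2

/-- **THE ORDER-16 HOST LIST OF `(2,1,1)⁴`, TYPE BY TYPE (kernel): of the five abelian groups of order `16`, exactly `ℤ/2 × ℤ/8`,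
`ℤ/4 × ℤ/4`, `ℤ/2 × ℤ/2 × ℤ/4` host; `ℤ/16` and `(ℤ/2)⁴` do not.** [cite: CohnKleinbergSzegedyUmans2005, Def. 5.1] -/
theorem stpp211pow4_order16_hosts :
    ((∃ A B C : Fin 4 → Finset (ZMod 2 × ZMod 8), IsSTPP A B C ∧ ∀ i, (A i).card = 2 ∧ (B i).card = 1 ∧ (C i).card = 1) ∧
      (∃ A B C : Fin 4 → Finset (ZMod 4 × ZMod 4), IsSTPP A B C ∧ ∀ i, (A i).card = 2 ∧ (B i).card = 1 ∧ (C i).card = 1) ∧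
      (∃ A B C : Fin 4 → Finset (ZMod 2 × ZMod 2 × ZMod 4), IsSTPP A B C ∧
        ∀ i, (A i).card = 2 ∧ (B i).card = 1 ∧ (C i).card = 1)) ∧
    (¬ ∃ A B C : Fin 4 → Finset (ZMod 16), IsSTPP A B C ∧ ∀ i, (A i).card = 2 ∧ (B i).card = 1 ∧ (C i).card = 1) ∧
    (¬ ∃ A B C : Fin 4 → Finset (ZMod 2 × ZMod 2 × ZMod 2 × ZMod 2), IsSTPP A B C ∧
      ∀ i, (A i).card = 2 ∧ (B i).card = 1 ∧ (C i).card = 1) :=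
  ⟨⟨exists_isSTPP_211pow4_zmod2_zmod8, exists_isSTPP_211pow4_zmod4_zmod4, exists_isSTPP_211pow4_zmod2_zmod2_zmod4⟩,
    not_exists_isSTPP_211pow4_zmod16, not_exists_isSTPP_211pow4_z2_z2_z2_z2⟩

/-- **SAME SHAPE AT ORDERS 16 AND 32** (kernel): for finite abelian `G` of order `16` and `G'` of order `32`,
`G` hosts `(2,1,1)⁴` iff `G` is neither cyclic nor elementary abelian, and `G'` hosts `(1,2,2)⁴` iff `G'` is neither cyclic nor
elementary abelian — the lift-tight law `onset_T2(4) = 2 · onset_T1(4)` of STRUCTURE B5 holds with matching exception lists.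
[cite: CohnKleinbergSzegedyUmans2005, Def. 5.1] -/
theorem stpp_order16_order32_same_shape {G G' : Type*} [AddCommGroup G] [Finite G] [AddCommGroup G'] [Finite G']
    (hG : Nat.card G = 16) (hG' : Nat.card G' = 32) :
    ((∃ A B C : Fin 4 → Finset G, IsSTPP A B C ∧ ∀ i, (A i).card = 2 ∧ (B i).card = 1 ∧ (C i).card = 1) ↔
        (¬ IsAddCyclic G ∧ ¬ ∀ x : G, 2 • x = 0)) ∧
      ((∃ A B C : Fin 4 → Finset G', IsSTPP A B C ∧ ∀ i, (A i).card = 1 ∧ (B i).card = 2 ∧ (C i).card = 2) ↔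
        (¬ IsAddCyclic G' ∧ ¬ ∀ x : G', 2 • x = 0)) :=
  ⟨stpp211pow4_order16_iff hG, stpp122pow4_order32_iff hG'⟩

end Summit.MatrixMultiplication.OmegaCensus
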